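import Summits.RiemannHypothesis.RiemannHypothesis.Theorems.SuzukiWindowsDoorArchLeadingTerm
import Summits.RiemannHypothesis.RiemannHypothesis.Theorems.SuzukiWindowsDoorLaplacePowerReal

/-!
# SuzukiWindowsDoorArchLeadingTermReal — the small-`x` law `g_θ(x) = (2π)^θ x^{θ−1} e^{−x/2}/Γ(θ)·(1 + O(x))` for every REAL `θ > 1` (column DBR; RH-FREE)

RH-FREE throughout; nothing here bears on the truth of RH.  The real-exponent companion of eng-3 g5's
`SuzukiWindowsDoorArchLeadingSymbol` / `SuzukiWindowsDoorArchLeadingTerm` (integer `θ = k+1`): for every REAL `θ > 1`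
(Suzuki's full one-parameter family [Su20] (1.10); DATA-1b's `θ ∈ {5/4, 3/2}`, EXP-R2a's pair `3/2 → 2`, theory's
`θ → 1⁺` regime):

* §1 the exact factorisation `Θ_θ^arch(z) = (2π)^θ (s^θ)⁻¹ exp(w_θ(s))`, `s = ½ − iz` (principal `cpow`; the correction
  `w_θ` and its bound `‖w_θ(s)‖ ≤ 6θ/‖s‖` are g5's `norm_correction_le`, already stated for real `θ`), and
  **`norm_limThetaArch_sub_leading_le_real`**: `‖Θ_θ^arch(z) − (2π)^θ (s^θ)⁻¹‖ ≤ 12θ(2π)^θ/‖s‖^{θ+1}` for `Re s ≥ 6θ`;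
* §2 the power integrand `((½ − iz)^θ)⁻¹ e^{−izx}` on the line `Im z = b` (bounds, integrability for `θ > 1`);
* §3 **`norm_archTransform_sub_leading_le_real`** (`‖ĝ_θ(x) − (2π)^θ(max x 0)^{θ−1}e^{−x/2}/Γ(θ)‖ ≤ 6θ(2π)^θσ^{−θ}e^{(σ−½)x}`,
  every `σ ≥ 6θ`, via `SuzukiWindowsDoorLaplacePowerReal.invFourierLine_inv_cpow`) and the small-`x` law
  **`abs_limArchKernel_sub_leading_le_real`** / **`abs_limKernel_sub_leading_le_real`**:
  `|g_θ(x) − (2π)^θ x^{θ−1}e^{−x/2}/Γ(θ)| ≤ 6θ(2πe·x/θ)^θ e^{−x/2}` for `0 < x ≤ 1/6` (line `σ = θ/x`), the same for `K_θ`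
  (first window), i.e. `K_θ(x) = c_θ x^{θ−1}e^{−x/2}(1 + O(x))`, `c_θ = (2π)^θ/Γ(θ)`, for ALL real `θ > 1`.

References: [Su20] M. Suzuki, ASPM 84 (2020) = arXiv:1907.07302, (1.10)–(1.12), §3; DLMF 5.11.2; DATA.md §ET1f-lite, §ET1i.
-/

noncomputable section

-- D-0017: `Summit.<S>.<S>.…` is the designed namespace of a single-problem summit.
set_option linter.dupNamespace false

open MeasureTheory Set Filter Topology Complex

namespace Summit.RiemannHypothesis.RiemannHypothesis.Theorems.SuzukiWindowsDoorArchLeadingTermReal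

open Literature.NumberTheory.LFunctions
open SuzukiWindowsDoorArchKernel (re_half_sub_I_mul invFourierLine_limThetaArch_eq integrable_limThetaArch_lineIntegrand
  integrable_one_add_abs_rpow_neg)
open SuzukiWindowsDoorArchLeadingSymbol (logDeriv_xiGammaFactor_eq log_half_eq norm_correction_le)
open SuzukiWindowsDoorArchLeadingTerm (re_half_sub_line normSq_half_sub_line integral_inv_sq_add_sq
  integrable_inv_sq_add_sq invFourierLine_sub_const_mul)
open SuzukiWindowsDoorLaplacePowerReal (invFourierLine_inv_cpow)
open SuzukiWindowsDoorWindowIdentity (limKernel_eq_limArchKernel_of_lt_log_two)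

variable {θ : ℝ}

/-! ## §1 The exact factorisation and the Stirling remainder for real `θ` -/

/-- RH-FREE.  **Exact factorisation, real exponent**: for `Im z > ½`, `s = ½ − iz` and real `θ`,
`Θ_θ^arch(z) = (2π)^θ · (s^θ)⁻¹ · exp(w_θ(s))`,
`w_θ(s) = −θ/s − 2θ/(s−1) + θ/(3s²) − θ·(ψ(s/2) − (log(s/2) − 1/s − 1/(3s²)))` (principal powers). -/
theorem limThetaArch_eq_leading_mul_exp_real (θ : ℝ) {z : ℂ} (hz : 1 / 2 < z.im) :
    limThetaArch θ z =
      (((2 * Real.pi) ^ θ : ℝ) : ℂ) * (((1 : ℂ) / 2 - I * z) ^ (θ : ℂ))⁻¹ *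
        Complex.exp (-(θ : ℂ) / ((1 : ℂ) / 2 - I * z) - 2 * (θ : ℂ) / ((1 : ℂ) / 2 - I * z - 1)
          + (θ : ℂ) / (3 * ((1 : ℂ) / 2 - I * z) ^ 2)
          - (θ : ℂ) * (Complex.digamma (((1 : ℂ) / 2 - I * z) / 2)
              - (Complex.log (((1 : ℂ) / 2 - I * z) / 2) - 1 / ((1 : ℂ) / 2 - I * z)
                  - 1 / (3 * ((1 : ℂ) / 2 - I * z) ^ 2)))) := by
  set s : ℂ := (1 : ℂ) / 2 - I * z with hsdef
  have hre : 1 < s.re := by rw [hsdef, re_half_sub_I_mul]; linarith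
  have hre0 : 0 < s.re := by linarith
  have hs0 : s ≠ 0 := fun h => by rw [h] at hre; norm_num at hre
  have hs1 : s - 1 ≠ 0 := by
    intro h
    have h' := congrArg Complex.re h
    simp at h'
    linarith
  have h2π : (0 : ℝ) < 2 * Real.pi := by positivity
  unfold limThetaArch
  rw [← hsdef, logDeriv_xiGammaFactor_eq hre, log_half_eq hre0]
  -- the power `(2π)^θ` and `s^{-θ}` as exponentials
  have hpow : (((2 * Real.pi) ^ θ : ℝ) : ℂ) = Complex.exp ((θ : ℂ) * (Real.log (2 * Real.pi) : ℂ)) := by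
    rw [Real.rpow_def_of_pos h2π, Complex.ofReal_exp]
    push_cast
    ring_nf
  have hinv : (s ^ (θ : ℂ))⁻¹ = Complex.exp (-((θ : ℂ) * Complex.log s)) := by
    rw [Complex.cpow_def_of_ne_zero hs0, ← Complex.exp_neg]
    ring_nf
  rw [hpow, hinv, ← Complex.exp_add, ← Complex.exp_add]
  congr 1
  rw [Real.log_mul (by norm_num) Real.pi_pos.ne']
  push_cast
  field_simp
  ring

/-- RH-FREE.  **Stirling leading term of `Θ_θ^arch` with explicit remainder, real `θ ≥ 1`**: for `Re(½ − iz) ≥ 6θ`,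
`‖Θ_θ^arch(z) − (2π)^θ ((½ − iz)^θ)⁻¹‖ ≤ 12θ(2π)^θ / ‖½ − iz‖^{θ+1}`. -/
theorem norm_limThetaArch_sub_leading_le_real (hθ : 1 ≤ θ) {z : ℂ} (hz : 6 * θ ≤ ((1 : ℂ) / 2 - I * z).re) :
    ‖limThetaArch θ z - (((2 * Real.pi) ^ θ : ℝ) : ℂ) * (((1 : ℂ) / 2 - I * z) ^ (θ : ℂ))⁻¹‖ ≤
      12 * θ * (2 * Real.pi) ^ θ / ‖(1 : ℂ) / 2 - I * z‖ ^ (θ + 1) := by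
  set s : ℂ := (1 : ℂ) / 2 - I * z with hsdef
  have hθ0 : 0 ≤ θ := by linarith
  have hre2 : 2 ≤ s.re := by linarith
  have hzim : 1 / 2 < z.im := by
    have h := re_half_sub_I_mul z
    rw [← hsdef] at h
    linarith
  have hns : 6 * θ ≤ ‖s‖ := le_trans hz (Complex.re_le_norm s)
  have hns0 : 0 < ‖s‖ := by linarith
  have hs0 : s ≠ 0 := norm_pos_iff.1 hns0
  have h2π : 0 < 2 * Real.pi := by positivity
  set w : ℂ := -(θ : ℂ) / s - 2 * (θ : ℂ) / (s - 1) + (θ : ℂ) / (3 * s ^ 2)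
      - (θ : ℂ) * (Complex.digamma (s / 2) - (Complex.log (s / 2) - 1 / s - 1 / (3 * s ^ 2))) with hwdef
  have hw : ‖w‖ ≤ 6 * θ / ‖s‖ := norm_correction_le hθ0 hre2
  have hw1 : ‖w‖ ≤ 1 := by
    refine hw.trans ?_
    rw [div_le_one hns0]
    exact hns
  have hfac : limThetaArch θ z = (((2 * Real.pi) ^ θ : ℝ) : ℂ) * (s ^ (θ : ℂ))⁻¹ * Complex.exp w := by
    rw [limThetaArch_eq_leading_mul_exp_real θ hzim]
  rw [hfac, show (((2 * Real.pi) ^ θ : ℝ) : ℂ) * (s ^ (θ : ℂ))⁻¹ * Complex.exp w -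
      (((2 * Real.pi) ^ θ : ℝ) : ℂ) * (s ^ (θ : ℂ))⁻¹ =
      (((2 * Real.pi) ^ θ : ℝ) : ℂ) * (s ^ (θ : ℂ))⁻¹ * (Complex.exp w - 1) by ring,
    norm_mul, norm_mul, norm_inv, Complex.norm_cpow_real, Complex.norm_real,
    Real.norm_of_nonneg (Real.rpow_nonneg h2π.le θ)]
  have hexp : ‖Complex.exp w - 1‖ ≤ 2 * (6 * θ / ‖s‖) :=
    (Complex.norm_exp_sub_one_le hw1).trans (by linarith)
  have hsθ : 0 < ‖s‖ ^ θ := Real.rpow_pos_of_pos hns0 θ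
  calc (2 * Real.pi) ^ θ * (‖s‖ ^ θ)⁻¹ * ‖Complex.exp w - 1‖
      ≤ (2 * Real.pi) ^ θ * (‖s‖ ^ θ)⁻¹ * (2 * (6 * θ / ‖s‖)) :=
        mul_le_mul_of_nonneg_left hexp (by positivity)
    _ = 12 * θ * (2 * Real.pi) ^ θ / ‖s‖ ^ (θ + 1) := by
        rw [Real.rpow_add_one hns0.ne' θ]
        field_simp
        ring

/-! ## §2 The power integrand `((½ − i(u+ib))^θ)⁻¹` on the line `Im z = b` -/

/-- `σ^{θ−1}·(σ² + u²) ≤ ‖½ − i(u+ib)‖^{θ+1}`, `σ = ½ + b > 0`, `θ ≥ 1`. -/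
theorem rpow_mul_sq_le_norm_rpow (hθ : 1 ≤ θ) {b : ℝ} (hσ : 0 < 1 / 2 + b) (u : ℝ) :
    (1 / 2 + b) ^ (θ - 1) * ((1 / 2 + b) ^ 2 + u ^ 2) ≤ ‖(1 : ℂ) / 2 - I * ((u : ℂ) + (b : ℂ) * I)‖ ^ (θ + 1) := by
  have hN : 1 / 2 + b ≤ ‖(1 : ℂ) / 2 - I * ((u : ℂ) + (b : ℂ) * I)‖ := by
    have h := Complex.re_le_norm ((1 : ℂ) / 2 - I * ((u : ℂ) + (b : ℂ) * I))
    rwa [re_half_sub_line] at h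
  have hn0 : 0 < ‖(1 : ℂ) / 2 - I * ((u : ℂ) + (b : ℂ) * I)‖ := hσ.trans_le hN
  rw [show θ + 1 = (θ - 1) + 2 by ring, Real.rpow_add hn0, show (2 : ℝ) = ((2 : ℕ) : ℝ) by norm_num,
    Real.rpow_natCast, normSq_half_sub_line]
  exact mul_le_mul_of_nonneg_right (Real.rpow_le_rpow hσ.le hN (by linarith)) (by positivity)

/-- The power integrand is bounded on the line: `‖((½ − i(u+ib))^θ)⁻¹‖·‖½ − i(u+ib)‖⁻¹ ≤ σ^{−(θ−1)} (σ² + u²)⁻¹`;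
precisely `‖((½ − i(u+ib))^θ)⁻¹‖ ≤ σ^{−(θ−1)}(σ²+u²)⁻¹ · ‖½ − i(u+ib)‖` is not needed — we record the form used below:
`(‖½ − i(u+ib)‖^{θ+1})⁻¹ ≤ (σ^{θ−1})⁻¹ (σ² + u²)⁻¹`. -/
theorem inv_norm_rpow_line_le (hθ : 1 ≤ θ) {b : ℝ} (hσ : 0 < 1 / 2 + b) (u : ℝ) :
    (‖(1 : ℂ) / 2 - I * ((u : ℂ) + (b : ℂ) * I)‖ ^ (θ + 1))⁻¹ ≤
      ((1 / 2 + b) ^ (θ - 1))⁻¹ * ((1 / 2 + b) ^ 2 + u ^ 2)⁻¹ := by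
  rw [← mul_inv]
  exact inv_anti₀ (by positivity) (rpow_mul_sq_le_norm_rpow hθ hσ u)

/-- The power integrand times `e^{−i(u+ib)x}` is integrable along the line (`θ > 1`, `σ = ½ + b > 0`). -/
theorem integrable_inv_cpow_lineIntegrand (hθ : 1 < θ) {b : ℝ} (hσ : 0 < 1 / 2 + b) (x : ℝ) :
    Integrable fun u : ℝ => (((1 : ℂ) / 2 - I * ((u : ℂ) + (b : ℂ) * I)) ^ (θ : ℂ))⁻¹ *
      Complex.exp (-I * ((u : ℂ) + (b : ℂ) * I) * (x : ℂ)) := by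
  set σ : ℝ := 1 / 2 + b with hσdef
  have hθ0 : 0 < θ := by linarith
  set m : ℝ := min (σ ^ 2) 1 with hm
  have hmpos : 0 < m := lt_min (by positivity) one_pos
  have hm1 : m ≤ σ ^ 2 := min_le_left _ _
  have hm2 : m ≤ 1 := min_le_right _ _
  set c : ℝ := Real.sqrt (m / 2) with hc
  have hcpos : 0 < c := Real.sqrt_pos.mpr (by positivity)
  have hre : ∀ u : ℝ, ((1 : ℂ) / 2 - I * ((u : ℂ) + (b : ℂ) * I)).re = σ := fun u => by
    rw [re_half_sub_line]
  have hne : ∀ u : ℝ, ((1 : ℂ) / 2 - I * ((u : ℂ) + (b : ℂ) * I)) ≠ 0 := fun u h => by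
    have h' := congrArg Complex.re h
    rw [hre u, Complex.zero_re] at h'
    linarith
  -- `c (1+|u|) ≤ ‖s‖`
  have hlow : ∀ u : ℝ, c * (1 + |u|) ≤ ‖(1 : ℂ) / 2 - I * ((u : ℂ) + (b : ℂ) * I)‖ := fun u => by
    have hsq : (c * (1 + |u|)) ^ 2 ≤ ‖(1 : ℂ) / 2 - I * ((u : ℂ) + (b : ℂ) * I)‖ ^ 2 := by
      rw [mul_pow, hc, Real.sq_sqrt (by positivity), normSq_half_sub_line, ← hσdef]
      have habs : |u| ^ 2 = u ^ 2 := sq_abs u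
      nlinarith [abs_nonneg u, sq_nonneg (1 - |u|)]
    exact (pow_le_pow_iff_left₀ (by positivity) (norm_nonneg _) two_ne_zero).mp hsq
  have hmaj : Integrable (fun u : ℝ => (c ^ θ)⁻¹ * Real.exp (b * x) * (1 + |u|) ^ (-θ)) :=
    (integrable_one_add_abs_rpow_neg hθ).const_mul _
  refine hmaj.mono' ?_ (Eventually.of_forall fun u => ?_)
  · refine ((Continuous.inv₀ ?_ fun u => ?_).mul (by fun_prop)).aestronglyMeasurable
    · exact Continuous.cpow (by fun_prop) continuous_const fun u => by
        left; rw [hre u]; exact hσ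
    · exact (Complex.cpow_ne_zero_iff_of_exponent_ne_zero (by
        intro h; have := congrArg Complex.re h; simp at this; linarith)).mpr (hne u)
  · rw [norm_mul, norm_inv, Complex.norm_cpow_real,
      show ‖Complex.exp (-I * ((u : ℂ) + (b : ℂ) * I) * (x : ℂ))‖ = Real.exp (b * x) by
        rw [Complex.norm_exp]; congr 1
        simp only [Complex.mul_re, Complex.mul_im, Complex.neg_re, Complex.neg_im, Complex.add_re,
          Complex.add_im, Complex.I_re, Complex.I_im, Complex.ofReal_re, Complex.ofReal_im]
        ring]
    have hpos : 0 < c * (1 + |u|) := by positivity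
    have h1 : (c * (1 + |u|)) ^ θ ≤ ‖(1 : ℂ) / 2 - I * ((u : ℂ) + (b : ℂ) * I)‖ ^ θ :=
      Real.rpow_le_rpow hpos.le (hlow u) hθ0.le
    calc (‖(1 : ℂ) / 2 - I * ((u : ℂ) + (b : ℂ) * I)‖ ^ θ)⁻¹ * Real.exp (b * x)
        ≤ ((c * (1 + |u|)) ^ θ)⁻¹ * Real.exp (b * x) :=
          mul_le_mul_of_nonneg_right (inv_anti₀ (Real.rpow_pos_of_pos hpos θ) h1) (Real.exp_pos _).le
      _ = (c ^ θ)⁻¹ * Real.exp (b * x) * (1 + |u|) ^ (-θ) := by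
          rw [Real.mul_rpow hcpos.le (by positivity), mul_inv, Real.rpow_neg (by positivity)]
          ring

/-! ## §3 The line transform of the remainder and the small-`x` law, real `θ > 1` -/

/-- RH-FREE.  **The archimedean transform minus its Stirling leading term, real `θ > 1`**: for every `σ ≥ 6θ` and real `x`,
`‖ĝ_θ(x) − (2π)^θ (max x 0)^{θ−1} e^{−x/2}/Γ(θ)‖ ≤ 6θ (2π)^θ σ^{−θ} e^{(σ−½)x}`, `ĝ_θ(x) = invFourierLine Θ_θ^arch 1 x`. -/
theorem norm_archTransform_sub_leading_le_real (hθ : 1 < θ) {σ : ℝ} (hσ : 6 * θ ≤ σ) (x : ℝ) :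
    ‖invFourierLine (limThetaArch θ) 1 x -
        (((2 * Real.pi) ^ θ : ℝ) : ℂ) * (((max x 0) ^ (θ - 1) * Real.exp (-(x / 2)) / Real.Gamma θ : ℝ) : ℂ)‖ ≤
      6 * θ * (2 * Real.pi) ^ θ / σ ^ θ * Real.exp ((σ - 1 / 2) * x) := by
  have hθ1 : 1 ≤ θ := hθ.le
  have hσ6 : 6 < σ := by linarith
  have hσpos : 0 < σ := by linarith
  have h2π : 0 < 2 * Real.pi := by positivity
  set b : ℝ := σ - 1 / 2 with hbdef
  have hb : 1 / 2 < b := by rw [hbdef]; linarith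
  have hb' : -1 / 2 < b := by linarith
  have hσb : 1 / 2 + b = σ := by rw [hbdef]; ring
  have hσb' : 0 < 1 / 2 + b := by rw [hσb]; exact hσpos
  have hA : invFourierLine (limThetaArch θ) 1 x = invFourierLine (limThetaArch θ) b x :=
    invFourierLine_limThetaArch_eq hθ (by norm_num) hb x
  have hP : invFourierLine (fun z : ℂ => (((1 : ℂ) / 2 - I * z) ^ (θ : ℂ))⁻¹) b x =
      (((max x 0) ^ (θ - 1) * Real.exp (-(x / 2)) / Real.Gamma θ : ℝ) : ℂ) := invFourierLine_inv_cpow hθ hb' x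
  have hIΘ := integrable_limThetaArch_lineIntegrand hθ hb x
  have hIP := integrable_inv_cpow_lineIntegrand hθ hσb' x
  rw [hA, ← hP, ← invFourierLine_sub_const_mul (Φ := limThetaArch θ)
    (Ψ := fun z : ℂ => (((1 : ℂ) / 2 - I * z) ^ (θ : ℂ))⁻¹) ((((2 * Real.pi) ^ θ : ℝ) : ℂ)) x hIΘ hIP]
  refine (norm_invFourierLine_le _ b x).trans ?_
  have hC : 0 ≤ 12 * θ * (2 * Real.pi) ^ θ * (σ ^ (θ - 1))⁻¹ := by positivity
  have hpt : ∀ u : ℝ, ‖limThetaArch θ ((u : ℂ) + (b : ℂ) * I) -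
        (((2 * Real.pi) ^ θ : ℝ) : ℂ) * ((((1 : ℂ) / 2 - I * ((u : ℂ) + (b : ℂ) * I)) ^ (θ : ℂ))⁻¹)‖ ≤
      12 * θ * (2 * Real.pi) ^ θ * (σ ^ (θ - 1))⁻¹ * (σ ^ 2 + u ^ 2)⁻¹ := by
    intro u
    have hre : 6 * θ ≤ ((1 : ℂ) / 2 - I * ((u : ℂ) + (b : ℂ) * I)).re := by
      rw [re_half_sub_line, hσb]; exact hσ
    refine (norm_limThetaArch_sub_leading_le_real hθ1 hre).trans ?_
    have hden := inv_norm_rpow_line_le hθ1 hσb' u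
    rw [hσb] at hden
    rw [div_eq_mul_inv, mul_assoc (12 * θ * (2 * Real.pi) ^ θ)]
    exact mul_le_mul_of_nonneg_left hden (by positivity)
  have hint : ∫ u : ℝ, ‖limThetaArch θ ((u : ℂ) + (b : ℂ) * I) -
        (((2 * Real.pi) ^ θ : ℝ) : ℂ) * ((((1 : ℂ) / 2 - I * ((u : ℂ) + (b : ℂ) * I)) ^ (θ : ℂ))⁻¹)‖ ≤
      12 * θ * (2 * Real.pi) ^ θ * (σ ^ (θ - 1))⁻¹ * (Real.pi / σ) := by
    rw [← integral_inv_sq_add_sq hσpos, ← integral_const_mul]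
    exact integral_mono_of_nonneg (Eventually.of_forall fun u => norm_nonneg _)
      ((integrable_inv_sq_add_sq hσpos).const_mul _) (Eventually.of_forall hpt)
  calc 1 / (2 * Real.pi) * Real.exp (b * x) *
        ∫ u : ℝ, ‖limThetaArch θ ((u : ℂ) + (b : ℂ) * I) -
          (((2 * Real.pi) ^ θ : ℝ) : ℂ) * ((((1 : ℂ) / 2 - I * ((u : ℂ) + (b : ℂ) * I)) ^ (θ : ℂ))⁻¹)‖
      ≤ 1 / (2 * Real.pi) * Real.exp (b * x) *
          (12 * θ * (2 * Real.pi) ^ θ * (σ ^ (θ - 1))⁻¹ * (Real.pi / σ)) := by gcongr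
    _ = 6 * θ * (2 * Real.pi) ^ θ / σ ^ θ * Real.exp ((σ - 1 / 2) * x) := by
        rw [hbdef, show σ ^ θ = σ ^ (θ - 1) * σ by
          rw [show θ = (θ - 1) + 1 by ring, Real.rpow_add_one hσpos.ne' (θ - 1), show θ - 1 + 1 - 1 = θ - 1 by ring]]
        field_simp
        ring

/-- RH-FREE.  **SMALL-`x` LAW FOR `g_θ`, every real `θ > 1`**: for `0 < x ≤ 1/6`,
`|g_θ(x) − (2π)^θ x^{θ−1} e^{−x/2}/Γ(θ)| ≤ 6θ · (2πe·x/θ)^θ · e^{−x/2}` (the line `σ = θ/x`).  In relative form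
`g_θ(x) = c_θ x^{θ−1}e^{−x/2}(1 + ρ(x))`, `c_θ = (2π)^θ/Γ(θ)`, `|ρ(x)| ≤ 6θ e^θ Γ(θ) θ^{−θ} · x`. -/
theorem abs_limArchKernel_sub_leading_le_real (hθ : 1 < θ) {x : ℝ} (hx0 : 0 < x) (hx : x ≤ 1 / 6) :
    |limArchKernel θ x - (2 * Real.pi) ^ θ * (x ^ (θ - 1) * Real.exp (-(x / 2)) / Real.Gamma θ)| ≤
      6 * θ * (2 * Real.pi * Real.exp 1 * x / θ) ^ θ * Real.exp (-(x / 2)) := by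
  have hθpos : 0 < θ := by linarith
  have h2π : 0 < 2 * Real.pi := by positivity
  set σ : ℝ := θ / x with hσdef
  have hσpos : 0 < σ := div_pos hθpos hx0
  have hσ : 6 * θ ≤ σ := by
    rw [hσdef, le_div_iff₀ hx0]
    nlinarith
  have h := norm_archTransform_sub_leading_le_real hθ hσ x
  have hre : limArchKernel θ x - (2 * Real.pi) ^ θ * (x ^ (θ - 1) * Real.exp (-(x / 2)) / Real.Gamma θ) =
      (invFourierLine (limThetaArch θ) 1 x -
        (((2 * Real.pi) ^ θ : ℝ) : ℂ) * (((max x 0) ^ (θ - 1) * Real.exp (-(x / 2)) / Real.Gamma θ : ℝ) : ℂ)).re := by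
    rw [max_eq_left hx0.le, Complex.sub_re, Complex.re_ofReal_mul]
    rfl
  rw [hre]
  refine (Complex.abs_re_le_norm _).trans (h.trans (le_of_eq ?_))
  -- `6θ(2π)^θ/σ^θ · e^{(σ−½)x} = 6θ (2πe x/θ)^θ e^{−x/2}` for `σ = θ/x`
  have hexp : Real.exp ((σ - 1 / 2) * x) = Real.exp 1 ^ θ * Real.exp (-(x / 2)) := by
    rw [Real.exp_one_rpow θ, ← Real.exp_add]
    congr 1
    rw [hσdef]
    field_simp
    ring
  rw [hexp, hσdef, Real.div_rpow (by positivity) hθpos.le, Real.mul_rpow (by positivity) hx0.le,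
    Real.mul_rpow h2π.le (Real.exp_pos 1).le, Real.div_rpow hθpos.le hx0.le]
  field_simp

/-- RH-FREE.  **SMALL-`x` LAW FOR `K_θ`, every real `θ > 1`**: by the first-window theorem `K_θ = g_θ` on `(−∞, log 2)`,
the same bound holds for Suzuki's kernel `limKernel θ` on `0 < x ≤ 1/6`. -/
theorem abs_limKernel_sub_leading_le_real (hθ : 1 < θ) {x : ℝ} (hx0 : 0 < x) (hx : x ≤ 1 / 6) :
    |limKernel θ x - (2 * Real.pi) ^ θ * (x ^ (θ - 1) * Real.exp (-(x / 2)) / Real.Gamma θ)| ≤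
      6 * θ * (2 * Real.pi * Real.exp 1 * x / θ) ^ θ * Real.exp (-(x / 2)) := by
  have hlog : x < Real.log 2 := by linarith [Real.log_two_gt_d9]
  rw [limKernel_eq_limArchKernel_of_lt_log_two hθ hlog]
  exact abs_limArchKernel_sub_leading_le_real hθ hx0 hx

end Summit.RiemannHypothesis.RiemannHypothesis.Theorems.SuzukiWindowsDoorArchLeadingTermReal

end
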